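import Mathlib.LinearAlgebra.FreeModule.PID
import Mathlib.LinearAlgebra.FreeModule.Finite.Basic
import Mathlib.FieldTheory.AlgebraicClosure
import Literature.FieldTheory.Kummer.RadicalDenominators
import Literature.FieldTheory.Kummer.CyclotomicRadicalBound
import Literature.FieldTheory.Regular.FiniteAlgebraicClosure
import HarnessLib

/-!
# Bounded denominators for radicals in finitely generated extensions of `ℚ(μ_∞)`

Let `Ω` be algebraically closed of characteristic `0`, `μ` its roots of unity, `G ⊆ Ω` finite and
`K = ℚ(μ)(G)`. If `v₁, …, v_s ∈ Kˣ` are multiplicatively independent modulo `μ`, then there is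
`m₀ ≥ 1` such that every relation `zᴺ = ζ ∏ vᵢ^{uᵢ}` with `z ∈ K`, `ζ ∈ μ` forces `N ∣ m₀ uᵢ`
(Zilber 2006, Thm 2 / Lemma; Bays–Zilber 2011, Prop. 2.5 (second case: `Kˣ/μ` is locally free)
with Lemma 5.1; Bays–Kirby 2018, Prop. 3.24). Proof: let `F' ⊆ K` be the relative algebraic
closure of `ℚ(μ)` in `K`, a finite extension `ℚ(μ)(s)` (`Regular/FiniteAlgebraicClosure`); split
`ℤˢ ⊇ Λ₁ = {u : vᵘ ∈ F'}` (a saturated lattice): lifts of a basis of `ℤˢ/Λ₁` give monomials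
independent modulo `F'ˣ`, to which the function-field denominator bound
(`RadicalDenominators`, here with a unit factor from the base) applies, and a basis of `Λ₁` gives
monomials in `F'` independent modulo `μ`, to which the bound over `ℚ(μ)`
(`CyclotomicRadicalBound`) applies.

* `Literature.FieldTheory.Kummer.RadicalBoundFG.exists_denominator_bound_smul` — the function-field
  bound with a factor from the base;
* `Literature.FieldTheory.Kummer.RadicalBoundFG.exists_dvd_of_mem_closure_fg` — the statement above.

## References

* B. Zilber, *Covers of the multiplicative group of an algebraically closed field of
  characteristic zero*, J. LMS 74 (2006), §2 (Thm 2, case `n = 0`).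
* M. Bays, B. Zilber, *Covers of multiplicative groups of algebraically closed fields of arbitrary
  characteristic*, Bull. LMS 43 (2011), Prop. 2.5, Lemma 5.1, Thm 2.3.
* M. Bays, J. Kirby, *Pseudo-exponential maps, variants, and quasiminimality*, Algebra & Number
  Theory 12 (2018), Prop. 3.22, Prop. 3.24.
-/

noncomputable section

open scoped IntermediateField

namespace Literature.FieldTheory.Kummer

namespace RadicalBoundFG

universe u

/-! ### Monomial bookkeeping -/

section Monomials

variable {Ω : Type*} [Field Ω] {s : ℕ}

/-- `v ^ (∑ g j) = ∏ v ^ g j` for `v ≠ 0`. [folklore] -/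
theorem zpow_finset_sum {v : Ω} (hv : v ≠ 0) {ι : Type*} (t : Finset ι) (g : ι → ℤ) :
    v ^ (∑ j ∈ t, g j) = ∏ j ∈ t, v ^ g j := by
  classical
  induction t using Finset.induction_on with
  | empty => simp
  | insert j t hj ih => rw [Finset.sum_insert hj, Finset.prod_insert hj, zpow_add₀ hv, ih]

/-- Monomials are additive in the exponent. [folklore] -/
theorem prod_zpow_add (v : Fin s → Ω) (hv0 : ∀ i, v i ≠ 0) (a b : Fin s → ℤ) :
    ∏ i, v i ^ (a + b) i = (∏ i, v i ^ a i) * ∏ i, v i ^ b i := by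
  rw [← Finset.prod_mul_distrib]
  exact Finset.prod_congr rfl fun i _ => by rw [Pi.add_apply, zpow_add₀ (hv0 i)]

/-- A monomial in monomials: `v ^ (∑ⱼ fⱼ Cⱼ) = ∏ⱼ (v ^ Cⱼ) ^ fⱼ`. [folklore] -/
theorem prod_zpow_sum_smul (v : Fin s → Ω) (hv0 : ∀ i, v i ≠ 0) {ι : Type*} [Fintype ι]
    (f : ι → ℤ) (C : ι → Fin s → ℤ) :
    ∏ i, v i ^ (∑ j, f j • C j) i = ∏ j, (∏ i, v i ^ C j i) ^ f j := by
  have h1 : ∀ i, (∑ j, f j • C j) i = ∑ j, f j * C j i := fun i => by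
    rw [Finset.sum_apply]
    exact Finset.sum_congr rfl fun j _ => by rw [Pi.smul_apply, smul_eq_mul]
  simp_rw [h1]
  rw [show (∏ i, v i ^ ∑ j, f j * C j i) = ∏ i, ∏ j, v i ^ (f j * C j i) from
    Finset.prod_congr rfl fun i _ => zpow_finset_sum (hv0 i) _ _]
  rw [Finset.prod_comm]
  refine Finset.prod_congr rfl fun j _ => ?_
  rw [← Finset.prod_zpow]
  exact Finset.prod_congr rfl fun i _ => by rw [mul_comm, zpow_mul]

/-- Scaling the exponent: `v ^ (n u) = (v ^ u) ^ n`. [folklore] -/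
theorem prod_zpow_int_mul (v : Fin s → Ω) (n : ℤ) (u : Fin s → ℤ) :
    ∏ i, v i ^ (n * u i) = (∏ i, v i ^ u i) ^ n := by
  rw [← Finset.prod_zpow]
  exact Finset.prod_congr rfl fun i _ => by rw [mul_comm, zpow_mul]

end Monomials

/-! ### Lattices: complements of saturated sublattices, bases of sublattices -/

section Lattice

/-- **A saturated sublattice has a complement**: if `Λ ≤ ℤˢ` is saturated (`n u ∈ Λ`, `n ≠ 0`
implies `u ∈ Λ`), there are vectors `C₁, …, C_{s₂}` (lifts of a basis of the free module `ℤˢ/Λ`)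
such that every `u` is congruent modulo `Λ` to an integer combination of the `Cⱼ`, and a
combination `∑ wⱼ Cⱼ` lies in `Λ` only if `w = 0`. [folklore] -/
theorem exists_complement_of_saturated {s : ℕ} (Λ : Submodule ℤ (Fin s → ℤ))
    (hsat : ∀ (n : ℤ) (u : Fin s → ℤ), n ≠ 0 → n • u ∈ Λ → u ∈ Λ) :
    ∃ (s₂ : ℕ) (C : Fin s₂ → Fin s → ℤ),
      (∀ u : Fin s → ℤ, ∃ f : Fin s₂ → ℤ, u - ∑ j, f j • C j ∈ Λ) ∧
      (∀ w : Fin s₂ → ℤ, ∑ j, w j • C j ∈ Λ → w = 0) := by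
  classical
  have hmem : ∀ x, x ∈ Λ ↔ Submodule.mkQ Λ x = 0 := fun x => by
    rw [Submodule.mkQ_apply, Submodule.Quotient.mk_eq_zero]
  haveI : NoZeroSMulDivisors ℤ ((Fin s → ℤ) ⧸ Λ) := by
    refine ⟨fun {n x} h => ?_⟩
    obtain ⟨u, rfl⟩ := Submodule.mkQ_surjective Λ x
    by_cases hn : n = 0
    · exact Or.inl hn
    · right
      rw [← map_zsmul, ← hmem] at h
      rw [← hmem]
      exact hsat n u hn h
  haveI : Module.Finite ℤ ((Fin s → ℤ) ⧸ Λ) := Module.Finite.quotient ℤ Λ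
  haveI : Module.Free ℤ ((Fin s → ℤ) ⧸ Λ) := Module.free_of_finite_type_torsion_free'
  let ι := Module.Free.ChooseBasisIndex ℤ ((Fin s → ℤ) ⧸ Λ)
  let b : Module.Basis (Fin (Fintype.card ι)) ℤ ((Fin s → ℤ) ⧸ Λ) :=
    (Module.Free.chooseBasis ℤ ((Fin s → ℤ) ⧸ Λ)).reindex (Fintype.equivFin ι)
  have hC : ∀ j, ∃ u : Fin s → ℤ, Submodule.mkQ Λ u = b j := fun j =>
    Submodule.mkQ_surjective Λ (b j)
  choose C hC using hC
  refine ⟨Fintype.card ι, C, fun u => ?_, fun w hw => ?_⟩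
  · refine ⟨fun j => b.repr (Submodule.mkQ Λ u) j, ?_⟩
    rw [hmem, map_sub, map_sum]
    simp_rw [map_zsmul, hC]
    rw [b.sum_repr, sub_self]
  · rw [hmem, map_sum] at hw
    simp_rw [map_zsmul, hC] at hw
    exact funext fun j => (Fintype.linearIndependent_iff.1 b.linearIndependent) w hw j

/-- **Bases of sublattices**: a submodule `Λ ≤ ℤˢ` has a `ℤ`-basis `B₁, …, B_{s₁}`
(`Submodule.basisOfPid`). [folklore] -/
theorem exists_basis_submodule {s : ℕ} (Λ : Submodule ℤ (Fin s → ℤ)) :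
    ∃ (s₁ : ℕ) (B : Fin s₁ → Fin s → ℤ), (∀ l, B l ∈ Λ) ∧ LinearIndependent ℤ B ∧
      ∀ u ∈ Λ, ∃ e : Fin s₁ → ℤ, u = ∑ l, e l • B l := by
  obtain ⟨n, bΛ⟩ := Submodule.basisOfPid (Pi.basisFun ℤ (Fin s)) Λ
  refine ⟨n, fun l => (bΛ l : Fin s → ℤ), fun l => (bΛ l).2, ?_, fun u hu => ?_⟩
  · exact bΛ.linearIndependent.map' Λ.subtype (Submodule.ker_subtype Λ)
  · refine ⟨fun l => bΛ.repr ⟨u, hu⟩ l, ?_⟩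
    have h1 := bΛ.sum_repr ⟨u, hu⟩
    have h2 := congrArg (fun x : Λ => (x : Fin s → ℤ)) h1
    simp only [Submodule.coe_sum, Submodule.coe_smul] at h2
    exact h2.symm

end Lattice

/-! ### The function-field bound with a factor from the base -/

section Variant

open RadicalDenominators

variable {K L : Type u} [Field K] [Field L] [Algebra K L] [CharZero K]

/-- **Bounded denominators for radicals of monomials, with a unit factor from the base**
(the tree's `RadicalDenominators.exists_denominator_bound`, same proof, for relations
`xᵐ = f ∏ aᵢ^{vᵢ}` with `f ∈ Kˣ`: the `K`-trivial valuations do not see `f`).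
[cite: BaysKirby2018ANT, Prop. 3.24] -/
theorem exists_denominator_bound_smul
    (hfg : ∃ s : Finset L, IntermediateField.adjoin K (s : Set L) = ⊤)
    (hK : ∀ z : L, IsAlgebraic K z → z ∈ Set.range (algebraMap K L))
    {N : ℕ} (a : Fin N → Lˣ)
    (hind : ∀ w : Fin N → ℤ, ((∏ i, a i ^ w i : Lˣ) : L) ∈ Set.range (algebraMap K L) → w = 0) :
    ∃ m₀ : ℕ, 0 < m₀ ∧ ∀ (m : ℕ) (v : Fin N → ℤ) (x : Lˣ) (f : Kˣ),
      x ^ m = Units.map (algebraMap K L : K →* L) f * ∏ i, a i ^ v i →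
        ∀ i, (m : ℤ) ∣ m₀ * v i := by
  classical
  have hspan := span_ordVec_eq_top hfg hK a hind
  -- a basis of `ℚᴺ` among the order vectors
  obtain ⟨b, hbsub, hbspan, hbli⟩ := exists_linearIndependent ℚ (Set.range (ordVec (K := K) a))
  rw [hspan] at hbspan
  have hbfin : b.Finite := hbli.setFinite
  haveI : Fintype b := hbfin.fintype
  have hcard : Fintype.card b = N := by
    have h1 := linearIndependent_iff_card_eq_finrank_span.1 hbli
    rw [Set.finrank, Subtype.range_coe_subtype, Set.setOf_mem_eq, hbspan, finrank_top,
      Module.finrank_fintype_fun_eq_card, Fintype.card_fin] at h1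
    exact h1
  let e : b ≃ Fin N := Fintype.equivFinOfCardEq hcard
  have hval : ∀ x : b, ∃ v : KTrivVal K L, ordVec a v = x := fun x => hbsub x.2
  choose val hval using hval
  -- the integer matrix `M i j = ord_{vᵢ} aⱼ`
  set M : Matrix (Fin N) (Fin N) ℤ := fun i j => ord (val (e.symm i)).1 (a j) with hM
  have hMQ : (M.map (Int.cast : ℤ → ℚ)) = fun i => ((e.symm i : b) : Fin N → ℚ) := by
    funext i j
    rw [Matrix.map_apply, ← hval (e.symm i)]
    rfl
  have hli : LinearIndependent ℚ (M.map (Int.cast : ℤ → ℚ)).row := by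
    change LinearIndependent ℚ fun i => (M.map (Int.cast : ℤ → ℚ)) i
    rw [hMQ]
    exact hbli.comp _ e.symm.injective
  have hunit : IsUnit (M.map (Int.cast : ℤ → ℚ)) := Matrix.linearIndependent_rows_iff_isUnit.1 hli
  have hdet : M.det ≠ 0 := by
    intro h
    have h2 : (M.map (Int.cast : ℤ → ℚ)).det = 0 := by
      change ((Int.castRingHom ℚ).mapMatrix M).det = 0
      rw [← RingHom.map_det, h, map_zero]
    exact (Matrix.isUnit_iff_isUnit_det _ |>.1 hunit).ne_zero h2
  refine ⟨M.det.natAbs, Int.natAbs_pos.2 hdet, fun m v x f hx i => ?_⟩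
  -- the base unit `f` is invisible to `K`-trivial valuations
  have hordf : ∀ w : KTrivVal K L, ord w.1 (Units.map (algebraMap K L : K →* L) f) = 0 := fun w => by
    rw [ord, Units.coe_map, MonoidHom.coe_coe, w.2 (f : K) f.ne_zero, WithZero.log_one]
  -- apply the valuations: `M v = m · (ord_{vᵢ} x)ᵢ`
  have hMv : M.mulVec v = fun i => (m : ℤ) * ord (val (e.symm i)).1 x := by
    funext i
    have := congrArg (ord (val (e.symm i)).1) hx
    rw [ord_pow, ord_mul, hordf, zero_add, ord_prod_zpow] at this
    rw [this]
    change (∑ j, M i j * v j) = ∑ j, v j * ord (val (e.symm i)).1 (a j)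
    refine Finset.sum_congr rfl fun j _ => ?_
    rw [show M i j = ord (val (e.symm i)).1 (a j) from rfl, mul_comm]
  -- adjugate: `det M • v = adj M (M v) ∈ m ℤᴺ`
  have hadj : M.det • v = M.adjugate.mulVec (M.mulVec v) := by
    rw [Matrix.mulVec_mulVec, Matrix.adjugate_mul, Matrix.smul_mulVec, Matrix.one_mulVec]
  have hi := congrFun hadj i
  rw [hMv] at hi
  simp only [Pi.smul_apply, smul_eq_mul, Matrix.mulVec, dotProduct] at hi
  have hdvd : (m : ℤ) ∣ M.det * v i := by
    rw [hi]
    refine Finset.dvd_sum fun j _ => ?_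
    exact Dvd.intro (M.adjugate i j * ord (val (e.symm j)).1 x) (by ring)
  rcases Int.natAbs_eq M.det with h | h
  · rw [← h]; exact hdvd
  · rw [show (M.det.natAbs : ℤ) = -M.det by omega, neg_mul]
    exact (dvd_neg).2 hdvd

end Variant

/-! ### The main theorem -/

section Main

variable {Ω : Type u} [Field Ω]

/-- The range of the structure map of an intermediate field is the field itself. [folklore] -/
theorem range_algebraMap_intermediateField {F : Type*} [Field F] [Algebra F Ω]
    (k : IntermediateField F Ω) : Set.range (algebraMap k Ω) = (k : Set Ω) := by
  ext x
  constructor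
  · rintro ⟨y, rfl⟩; exact y.2
  · intro hx; exact ⟨⟨x, hx⟩, rfl⟩

variable [CharZero Ω]

/-- Roots of unity are integral over `ℚ`. [folklore] -/
theorem isIntegral_of_mem_allRoots_one {x : Ω} (hx : x ∈ allRoots (1 : Ω)) : IsIntegral ℚ x := by
  obtain ⟨k, hk, hxk⟩ := hx
  exact IsIntegral.of_pow hk (by rw [hxk]; exact isIntegral_one)

/-- `ℚ(μ)` as an intermediate field has the same closure as `μ`: for every `T`,
`closure (ℚ(μ) ∪ T) = closure (μ ∪ T)`. [folklore] -/
theorem closure_adjoin_union_eq (T : Set Ω) :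
    Subfield.closure (((IntermediateField.adjoin ℚ (allRoots (1 : Ω)) : IntermediateField ℚ Ω) :
        Set Ω) ∪ T) = Subfield.closure (allRoots (1 : Ω) ∪ T) := by
  apply le_antisymm
  · refine Subfield.closure_le.2 ?_
    rintro x (hx | hx)
    · -- `ℚ(μ) ≤ closure (μ ∪ T)` as intermediate fields
      let TT : IntermediateField ℚ Ω :=
        (Subfield.closure (allRoots (1 : Ω) ∪ T)).toIntermediateField fun q =>
          SubfieldClass.ratCast_mem _ q
      have hle : IntermediateField.adjoin ℚ (allRoots (1 : Ω)) ≤ TT :=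
        IntermediateField.adjoin_le_iff.2 fun y hy => Subfield.subset_closure (Or.inl hy)
      exact hle hx
    · exact Subfield.subset_closure (Or.inr hx)
  · exact Subfield.closure_mono (Set.union_subset_union_left _
      (IntermediateField.subset_adjoin ℚ (allRoots (1 : Ω))))

set_option maxHeartbeats 1000000 in
/-- **Bounded denominators for radicals in a finitely generated extension of `ℚ(μ_∞)`**
(Zilber 2006 Thm 2 (`n = 0`) / Bays–Zilber 2011 Prop. 2.5 + Lemma 5.1 / Bays–Kirby 2018
Prop. 3.24): `Ω` algebraically closed of characteristic `0`, `K = ℚ(μ)(G)` with `G` finite,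
`v₁, …, v_s ∈ Kˣ` multiplicatively independent modulo roots of unity. Then there is `m₀ ≥ 1`
such that `zᴺ = ζ ∏ vᵢ^{uᵢ}` (`z ∈ K`, `ζ ∈ μ`) implies `N ∣ m₀ uᵢ` for all `i`.
[cite: BaysZilber2011Covers, Prop. 2.5 and Thm 2.3] [cite: BaysKirby2018ANT, Prop. 3.24] -/
theorem exists_dvd_of_mem_closure_fg [IsAlgClosed Ω] (G : Finset Ω) {s : ℕ} (v : Fin s → Ω)
    (hvG : ∀ i, v i ∈ Subfield.closure (allRoots (1 : Ω) ∪ (G : Set Ω))) (hv0 : ∀ i, v i ≠ 0)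
    (hind : MulIndepModTorsion v) :
    ∃ m₀ : ℕ, 0 < m₀ ∧ ∀ z ∈ Subfield.closure (allRoots (1 : Ω) ∪ (G : Set Ω)),
      ∀ (N : ℕ) (u : Fin s → ℤ) (ζ : Ω), ζ ∈ allRoots (1 : Ω) →
        z ^ N = (∏ i, v i ^ u i) * ζ → ∀ i, (N : ℤ) ∣ m₀ * u i := by
  classical
  -- the base `k₀ = ℚ(μ)` and the field `K = k₀(G)`
  set k₀ : IntermediateField ℚ Ω := IntermediateField.adjoin ℚ (allRoots (1 : Ω)) with hk₀
  haveI hk₀alg : Algebra.IsAlgebraic ℚ k₀ :=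
    IntermediateField.isAlgebraic_adjoin fun x hx => isIntegral_of_mem_allRoots_one hx
  haveI : CharZero k₀ := charZero_of_injective_algebraMap (algebraMap ℚ k₀).injective
  set Kif : IntermediateField k₀ Ω := IntermediateField.adjoin k₀ (G : Set Ω) with hKif
  have hmemK : ∀ x, x ∈ Kif ↔ x ∈ Subfield.closure (allRoots (1 : Ω) ∪ (G : Set Ω)) := fun x => by
    rw [← IntermediateField.mem_toSubfield, hKif, IntermediateField.adjoin_toSubfield,
      range_algebraMap_intermediateField, closure_adjoin_union_eq]
  haveI : Algebra.EssFiniteType k₀ Kif :=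
    IntermediateField.essFiniteType_iff.2 (IntermediateField.fg_adjoin_finset G)
  -- the relative algebraic closure `F'' = k₀(sA)` of `k₀` in `K`
  obtain ⟨sA, hsAalg, hclos⟩ :=
    Literature.FieldTheory.Regular.exists_finset_isAlgClosedIn (k := k₀) (E := Kif)
  set F'' : IntermediateField k₀ Kif := IntermediateField.adjoin k₀ (sA : Set Kif) with hF''
  haveI hF''alg : Algebra.IsAlgebraic k₀ F'' :=
    IntermediateField.isAlgebraic_adjoin fun x hx => (hsAalg x hx).isIntegral
  -- `v` inside `K`
  let vE : Fin s → Kif := fun i => ⟨v i, (hmemK _).2 (hvG i)⟩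
  have hvE0 : ∀ i, vE i ≠ 0 := fun i h => hv0 i (congrArg Subtype.val h)
  have hvEcoe : ∀ u : Fin s → ℤ, ((∏ i, vE i ^ u i : Kif) : Ω) = ∏ i, v i ^ u i := fun u => by
    change algebraMap Kif Ω (∏ i, vE i ^ u i) = _
    rw [map_prod]
    exact Finset.prod_congr rfl fun i _ => by rw [map_zpow₀]; rfl
  -- the saturated lattice `Λ = {u : vᵘ ∈ F''}`
  let Λ : Submodule ℤ (Fin s → ℤ) :=
    { carrier := {u | (∏ i, vE i ^ u i : Kif) ∈ F''}
      add_mem' := fun {a b} ha hb => by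
        change (∏ i, vE i ^ (a + b) i : Kif) ∈ F''
        rw [prod_zpow_add vE hvE0]
        exact mul_mem ha hb
      zero_mem' := by
        change (∏ i, vE i ^ (0 : Fin s → ℤ) i : Kif) ∈ F''
        simp only [Pi.zero_apply, zpow_zero, Finset.prod_const_one]
        exact one_mem _
      smul_mem' := fun n u hu => by
        change (∏ i, vE i ^ (n • u) i : Kif) ∈ F''
        have : (∏ i, vE i ^ (n • u) i : Kif) = (∏ i, vE i ^ u i) ^ n := by
          rw [← prod_zpow_int_mul]
          rfl
        rw [this]
        exact zpow_mem hu n }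
  have hΛ : ∀ u, u ∈ Λ ↔ (∏ i, vE i ^ u i : Kif) ∈ F'' := fun u => Iff.rfl
  -- saturation: `K ∋ vᵘ` algebraic over `F''` lies in `F''`
  have halgmem : ∀ (x : Kif) (n : ℕ), 0 < n → x ^ n ∈ F'' → x ∈ F'' := by
    intro x n hn hxn
    apply hclos x
    have hint : IsIntegral F'' (x ^ n) := by
      have : x ^ n = algebraMap F'' Kif ⟨x ^ n, hxn⟩ := rfl
      rw [this]; exact isIntegral_algebraMap
    exact (IsIntegral.of_pow hn hint).isAlgebraic
  have hsat : ∀ (n : ℤ) (u : Fin s → ℤ), n ≠ 0 → n • u ∈ Λ → u ∈ Λ := by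
    intro n u hn hnu
    rw [hΛ] at hnu ⊢
    have hpow : (∏ i, vE i ^ (n • u) i : Kif) = (∏ i, vE i ^ u i) ^ n := by
      rw [← prod_zpow_int_mul]; rfl
    rw [hpow] at hnu
    rcases Int.natAbs_eq n with h | h
    · apply halgmem _ n.natAbs (Int.natAbs_pos.2 hn)
      rw [← zpow_natCast, ← h]; exact hnu
    · apply halgmem _ n.natAbs (Int.natAbs_pos.2 hn)
      rw [← zpow_natCast, show ((n.natAbs : ℕ) : ℤ) = -n by omega, zpow_neg]
      exact inv_mem hnu
  obtain ⟨s₂, C, hCdec, hCind⟩ := exists_complement_of_saturated Λ hsat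
  obtain ⟨s₁, Bv, hBmem, hBli, hBspan⟩ := exists_basis_submodule Λ
  -- (5) the function-field bound over `F''` for the monomials `v ^ Cⱼ`
  let a : Fin s₂ → (Kif)ˣ := fun j =>
    Units.mk0 (∏ i, vE i ^ C j i) (Finset.prod_ne_zero_iff.2 fun i _ => zpow_ne_zero _ (hvE0 i))
  have haprod : ∀ w : Fin s₂ → ℤ, ((∏ j, a j ^ w j : (Kif)ˣ) : Kif) = ∏ i, vE i ^ (∑ j, w j • C j) i := by
    intro w
    rw [prod_zpow_sum_smul vE hvE0, Units.coe_prod]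
    exact Finset.prod_congr rfl fun j _ => by rw [Units.val_zpow_eq_zpow_val]; rfl
  have hfg : ∃ t : Finset Kif, IntermediateField.adjoin F'' (t : Set Kif) = ⊤ := by
    let G' : Finset Kif := G.attach.image fun g =>
      (⟨g.1, (hmemK _).2 (Subfield.subset_closure (Or.inr g.2))⟩ : Kif)
    refine ⟨G', ?_⟩
    have hval : Subtype.val '' (G' : Set Kif) = (G : Set Ω) := by
      apply Set.eq_of_subset_of_subset
      · rintro _ ⟨y, hy, rfl⟩
        rw [Finset.mem_coe, Finset.mem_image] at hy
        obtain ⟨g, -, rfl⟩ := hy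
        exact g.2
      · intro x hx
        refine ⟨⟨x, (hmemK _).2 (Subfield.subset_closure (Or.inr hx))⟩, ?_, rfl⟩
        rw [Finset.mem_coe, Finset.mem_image]
        exact ⟨⟨x, hx⟩, Finset.mem_attach _ _, rfl⟩
    have htop : IntermediateField.adjoin k₀ (G' : Set Kif) = ⊤ := by
      apply IntermediateField.lift_injective Kif
      rw [IntermediateField.lift_adjoin, IntermediateField.lift_top, hval]
    rw [eq_top_iff]
    intro x _
    have hx : x ∈ IntermediateField.adjoin k₀ (G' : Set Kif) := by rw [htop]; trivial
    have hle : IntermediateField.adjoin k₀ (G' : Set Kif) ≤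
        (IntermediateField.adjoin F'' (G' : Set Kif)).restrictScalars k₀ :=
      IntermediateField.adjoin_le_iff.2 (IntermediateField.subset_adjoin F'' _)
    exact hle hx
  have hK' : ∀ z : Kif, IsAlgebraic F'' z → z ∈ Set.range (algebraMap F'' Kif) := fun z hz =>
    ⟨⟨z, hclos z hz⟩, rfl⟩
  have hinda : ∀ w : Fin s₂ → ℤ,
      ((∏ j, a j ^ w j : (Kif)ˣ) : Kif) ∈ Set.range (algebraMap F'' Kif) → w = 0 := by
    intro w hw
    obtain ⟨y, hy⟩ := hw
    apply hCind w
    rw [hΛ, ← haprod w, ← hy]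
    exact y.2
  obtain ⟨m₀', hm₀', hden⟩ := exists_denominator_bound_smul hfg hK' a hinda
  -- (6) the bound over `ℚ(μ)` for the monomials `v ^ Bₗ ∈ F''`
  let eA := sA.equivFin
  let θ : Fin sA.card → Ω := fun i => ((eA.symm i : sA) : Kif)
  have hθalg : ∀ i, IsAlgebraic ℚ (θ i) := fun i => by
    have h1 : IsAlgebraic k₀ ((eA.symm i : sA) : Kif) := hsAalg _ (eA.symm i).2
    have h2 : IsAlgebraic k₀ (θ i) := h1.algebraMap (A := Ω)
    exact h2.restrictScalars ℚ
  let v' : Fin s₁ → Ω := fun l => ∏ i, v i ^ Bv l i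
  have hv'0 : ∀ l, v' l ≠ 0 := fun l => Finset.prod_ne_zero_iff.2 fun i _ => zpow_ne_zero _ (hv0 i)
  have hv'alg : ∀ l, IsAlgebraic ℚ (v' l) := fun l => by
    have hmem : (∏ i, vE i ^ Bv l i : Kif) ∈ F'' := hBmem l
    have h1 : IsAlgebraic k₀ (⟨_, hmem⟩ : F'') := Algebra.IsAlgebraic.isAlgebraic _
    have h2 : IsAlgebraic k₀ (∏ i, vE i ^ Bv l i : Kif) := h1.algebraMap (A := Kif)
    have h3 : IsAlgebraic k₀ (v' l) := by
      have := h2.algebraMap (A := Ω)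
      rwa [show algebraMap Kif Ω (∏ i, vE i ^ Bv l i) = v' l from hvEcoe (Bv l)] at this
    exact h3.restrictScalars ℚ
  have hind' : MulIndepModTorsion v' := by
    intro e he
    have h1 : (∏ l, v' l ^ e l) = ∏ i, v i ^ (∑ l, e l • Bv l) i := (prod_zpow_sum_smul v hv0 e Bv).symm
    rw [h1] at he
    have h2 := hind _ he
    exact funext fun l => (Fintype.linearIndependent_iff.1 hBli) e h2 l
  obtain ⟨m₁, hm₁, hcyc⟩ :=
    CyclotomicRadicalBound.exists_dvd_of_mem_closure θ hθalg v' hv'alg hv'0 hind'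
  -- (7) combination
  refine ⟨m₁ * m₀', Nat.mul_pos hm₁ hm₀', fun z hz N u ζ hζ hrel i => ?_⟩
  obtain ⟨Mz, hMz, hζMz⟩ := hζ
  have hζ0 : ζ ≠ 0 := fun h => by
    rw [h, zero_pow hMz.ne'] at hζMz; exact zero_ne_one hζMz
  have hprod0 : ∀ w : Fin s → ℤ, (∏ i, v i ^ w i) ≠ 0 := fun w =>
    Finset.prod_ne_zero_iff.2 fun i _ => zpow_ne_zero _ (hv0 i)
  -- `N = 0`
  rcases Nat.eq_zero_or_pos N with hN | hN
  · subst hN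
    rw [pow_zero] at hrel
    have h1 : (∏ i, v i ^ u i) ^ Mz = 1 := by
      rw [eq_inv_of_mul_eq_one_left hrel.symm, inv_pow, hζMz, inv_one]
    rw [hind u ⟨Mz, hMz, h1⟩]
    simp
  have hz0 : z ≠ 0 := by
    intro h
    rw [h, zero_pow hN.ne'] at hrel
    exact mul_ne_zero (hprod0 u) hζ0 hrel.symm
  -- decompose `u = u₁ + ∑ fⱼ Cⱼ`, `u₁ = ∑ eₗ Bₗ ∈ Λ`
  obtain ⟨f, hf⟩ := hCdec u
  set u₁ : Fin s → ℤ := u - ∑ j, f j • C j with hu₁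
  obtain ⟨e, he⟩ := hBspan u₁ hf
  have hu : u = u₁ + ∑ j, f j • C j := by rw [hu₁, sub_add_cancel]
  have hvu : (∏ i, v i ^ u i) = (∏ i, v i ^ u₁ i) * ∏ j, (∏ i, v i ^ C j i) ^ f j := by
    conv_lhs => rw [hu]
    rw [prod_zpow_add v hv0, prod_zpow_sum_smul v hv0]
  -- the unit `g = v^{u₁} ζ ∈ F''`
  have hζK : ζ ∈ Kif := (hmemK ζ).2 (Subfield.subset_closure (Or.inl ⟨Mz, hMz, hζMz⟩))
  have hζk₀ : ζ ∈ k₀ := IntermediateField.subset_adjoin ℚ _ ⟨Mz, hMz, hζMz⟩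
  let ζK : Kif := ⟨ζ, hζK⟩
  have hζKF : ζK ∈ F'' := by
    have : ζK = algebraMap k₀ Kif ⟨ζ, hζk₀⟩ := Subtype.ext rfl
    rw [this]; exact F''.algebraMap_mem _
  let gK : Kif := (∏ i, vE i ^ u₁ i) * ζK
  have hgKF : gK ∈ F'' := mul_mem hf hζKF
  have hgKcoe : (gK : Ω) = (∏ i, v i ^ u₁ i) * ζ := by
    change ((∏ i, vE i ^ u₁ i : Kif) : Ω) * ζ = _
    rw [hvEcoe]
  have hgK0 : gK ≠ 0 := fun h => by
    have : (gK : Ω) = 0 := by rw [h]; rfl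
    rw [hgKcoe] at this
    exact mul_ne_zero (hprod0 u₁) hζ0 this
  let zE : Kif := ⟨z, (hmemK z).2 hz⟩
  have hzE0 : zE ≠ 0 := fun h => hz0 (congrArg Subtype.val h)
  let xU : (Kif)ˣ := Units.mk0 zE hzE0
  let fU : (F'')ˣ := Units.mk0 ⟨gK, hgKF⟩ (fun h => hgK0 (congrArg Subtype.val h))
  have hxUval : ((xU ^ N : (Kif)ˣ) : Kif) = zE ^ N := rfl
  have hfUval : ((Units.map (algebraMap F'' Kif : F'' →* Kif) fU * ∏ j, a j ^ f j : (Kif)ˣ) : Kif) =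
      gK * ∏ i, vE i ^ (∑ j, f j • C j) i := by
    rw [Units.val_mul, haprod]; rfl
  have hrelU : xU ^ N = Units.map (algebraMap F'' Kif : F'' →* Kif) fU * ∏ j, a j ^ f j := by
    apply Units.ext
    rw [hxUval, hfUval]
    apply Subtype.ext
    have h1 : ((zE ^ N : Kif) : Ω) = z ^ N := by rw [SubmonoidClass.coe_pow]
    have h2 : ((gK * ∏ i, vE i ^ (∑ j, f j • C j) i : Kif) : Ω) =
        (∏ i, v i ^ u₁ i) * ζ * ∏ j, (∏ i, v i ^ C j i) ^ f j := by
      rw [MulMemClass.coe_mul, hgKcoe, hvEcoe, prod_zpow_sum_smul v hv0]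
    rw [h1, h2, hrel, hvu]
    ring
  have hdvdf : ∀ j, ∃ c : ℤ, (m₀' : ℤ) * f j = N * c := fun j => hden N f xU fU hrelU j
  choose f' hf' using hdvdf
  -- `y = z^{m₀'} / ∏ (v^{Cⱼ})^{f'ⱼ}` has `yᴺ = g^{m₀'}`, hence lies in `F''`
  set P : Ω := ∏ j, (∏ i, v i ^ C j i) ^ f j with hP
  set P' : Ω := ∏ j, (∏ i, v i ^ C j i) ^ f' j with hP'
  have hP'0 : P' ≠ 0 := Finset.prod_ne_zero_iff.2 fun j _ => zpow_ne_zero _ (hprod0 _)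
  have hP'N : P' ^ N = P ^ m₀' := by
    rw [hP, hP', ← Finset.prod_pow, ← Finset.prod_pow]
    refine Finset.prod_congr rfl fun j _ => ?_
    rw [← zpow_natCast, ← zpow_mul, ← zpow_natCast, ← zpow_mul, mul_comm (f' j), ← hf' j, mul_comm]
  set yΩ : Ω := z ^ m₀' * P'⁻¹ with hyΩ
  have h1 : (∏ l, v' l ^ ((m₀' : ℤ) * e l)) = (∏ i, v i ^ u₁ i) ^ m₀' := by
    rw [he, prod_zpow_sum_smul v hv0, ← Finset.prod_pow]
    refine Finset.prod_congr rfl fun l _ => ?_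
    rw [← zpow_natCast, ← zpow_mul, mul_comm]
  have hyN : yΩ ^ N = (∏ l, v' l ^ ((m₀' : ℤ) * e l)) * ζ ^ m₀' := by
    have hP0 : P ≠ 0 := by
      rw [hP]; exact Finset.prod_ne_zero_iff.2 fun j _ => zpow_ne_zero _ (hprod0 _)
    rw [h1, hyΩ, mul_pow, ← pow_mul, mul_comm m₀' N, pow_mul, hrel, hvu, inv_pow, hP'N]
    field_simp
    ring
  let yE : Kif := zE ^ m₀' * (∏ j, (a j : Kif) ^ f' j)⁻¹
  have hyEcoe : (yE : Ω) = yΩ := by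
    change algebraMap Kif Ω (zE ^ m₀' * (∏ j, (a j : Kif) ^ f' j)⁻¹) = z ^ m₀' * P'⁻¹
    rw [map_mul, map_inv₀, map_pow, map_prod]
    congr 2
    rw [hP']
    refine Finset.prod_congr rfl fun j _ => ?_
    rw [map_zpow₀]
    change algebraMap Kif Ω (∏ i, vE i ^ C j i) ^ f' j = _
    rw [IntermediateField.algebraMap_apply, hvEcoe]
  have hyEN : yE ^ N = gK ^ m₀' := by
    apply Subtype.ext
    rw [SubmonoidClass.coe_pow, SubmonoidClass.coe_pow, hyEcoe, hyN, hgKcoe, mul_pow, h1]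
  have hyEF : yE ∈ F'' := by
    apply halgmem yE N hN
    rw [hyEN]
    exact pow_mem hgKF _
  -- `y ∈ ℚ(μ, sA, v')`
  have hyclos : yΩ ∈ Subfield.closure (allRoots (1 : Ω) ∪ Set.range θ ∪ Set.range v') := by
    rw [← hyEcoe]
    have h1 : (yE : Ω) ∈ IntermediateField.lift F'' := (IntermediateField.mem_lift yE).2 hyEF
    rw [hF'', IntermediateField.lift_adjoin] at h1
    let TT : IntermediateField k₀ Ω :=
      (Subfield.closure (allRoots (1 : Ω) ∪ Set.range θ ∪ Set.range v')).toIntermediateField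
        fun q => by
          rw [Set.union_assoc, ← closure_adjoin_union_eq]
          exact Subfield.subset_closure (Or.inl q.2)
    have hle : IntermediateField.adjoin k₀ (Subtype.val '' (sA : Set Kif)) ≤ TT := by
      refine IntermediateField.adjoin_le_iff.2 ?_
      rintro _ ⟨x, hx, rfl⟩
      refine Subfield.subset_closure (Or.inl (Or.inr ⟨eA ⟨x, hx⟩, ?_⟩))
      change (((eA.symm (eA ⟨x, hx⟩)) : sA) : Kif) = (x : Ω)
      rw [Equiv.symm_apply_apply]
    exact hle h1
  have hζpow : ζ ^ m₀' ∈ allRoots (1 : Ω) :=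
    ⟨Mz, hMz, by rw [← pow_mul, mul_comm, pow_mul, hζMz, one_pow]⟩
  have hdiv := fun l => hcyc yΩ hyclos N (fun l => (m₀' : ℤ) * e l) (ζ ^ m₀') hζpow hyN l
  -- conclusion: `N ∣ m₁ m₀' uᵢ`
  have hui : u i = (∑ l, e l * Bv l i) + ∑ j, f j * C j i := by
    have h1 := congrFun hu i
    rw [h1, Pi.add_apply, he, Finset.sum_apply, Finset.sum_apply]
    simp only [Pi.smul_apply, smul_eq_mul]
  rw [Nat.cast_mul, hui, mul_add, Finset.mul_sum, Finset.mul_sum]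
  refine dvd_add (Finset.dvd_sum fun l _ => ?_) (Finset.dvd_sum fun j _ => ?_)
  · have h1 : (m₁ : ℤ) * m₀' * (e l * Bv l i) = m₁ * (m₀' * e l) * Bv l i := by ring
    rw [h1]
    exact Dvd.dvd.mul_right (hdiv l) _
  · have h1 : (m₁ : ℤ) * m₀' * (f j * C j i) = N * (m₁ * f' j * C j i) := by
      have := hf' j
      calc (m₁ : ℤ) * m₀' * (f j * C j i) = m₁ * (m₀' * f j) * C j i := by ring
        _ = m₁ * (N * f' j) * C j i := by rw [this]
        _ = N * (m₁ * f' j * C j i) := by ring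
    rw [h1]
    exact Dvd.intro _ rfl

end Main

end RadicalBoundFG

end Literature.FieldTheory.Kummer
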